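import Mathlib
import HarnessLib
import Literature.MathematicalPhysics.QuantumLattice.GrassmannGramFormAlgebra

/-!
# Route `KLProgramme` — crux K3, the nested two-volume pass (β′ «semigroup defect»): the BLOCK DEFECT of a covariance on a block structure —
# decomposition `C′ = C^cop + D_near + D_far`, sizes of the two defects, and their Gram data (cell gate-hubbard-kl, seat hubbard-kl-k3c4-p1 g7)

Companion of `…TwoVolumeDefectStep` (k3c5-p2: `sum_norm_kernel_twoVolumeDefect_le`, the defect-covariance step for `C′ = C + Dn + Df` on ONE
Grassmann algebra) and of `Literature/…/GrassmannEffectiveActionCopies` (the decoupled reference `effAction C^cop (Σ_β V∘f_β) = Σ_β (effAction C V)∘f_β`).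
Here: the COVARIANCE side of the model-level work order (BETA-PRIME-ROADMAP.md (m1)/(m2)), model-free.  A block structure is a bijection
`e : Γ′ ≃ ι × Γ` (`blk X′ = (e X′).1`, `π X′ = (e X′).2`); `C` is the coarse covariance (torus `L`), `C′` the fine one (torus `bL`), and

* `C^cop X′ Y′ = [blk X′ = blk Y′]·C (π X′) (π Y′)` (decoupled copies), `D := C′ − C^cop` (the defect),
* for a zone `Zs ⊆ Γ′` (the legs within `R` of a block boundary): `D_far := 1_{Zs×Zs}·D`, `D_near := D − D_far`

(all three given to the theorems through their defining entries `hCcop`/`hDf`/`hDn`, as explicit `Matrix.of` terms at the call site).  Proved: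

* §1 `copies_add_near_add_far` (`C^cop + D_near + D_far = C′`), `far_apply_of_not` (`D_far` lives on `Zs × Zs`), `near_apply_of_mem`;
* §2 FAR SIZES from sup/row/column bounds of `C′` and `C`: `norm_far_le` (`≤ s′ + s`), `sum_norm_copies_row/col` (a row of `C^cop` is a row of `C`),
  `sum_norm_far_row_le/col_le` (`≤ α′ + α`);
* §3 NEAR SIZES — the two-volume content.  Hypotheses: (P) PERIODISATION `Σ_{π Y″ = Y} C′ X′ Y″ = C (π X′) Y` (the fine covariance summed over a
  fibre is the coarse one: `…VolumeLimitGridCovariancePeriodisation.hubbardGridSub_pullback_zero_one_periodise` for the programme's grid covariance);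
  a separation relation `Far` with (G1) «different blocks, not both in the zone ⇒ far» and (G2) «same block, not both in the zone ⇒ every OTHER
  point of the fibre of `Y′` is far from `X′`» (torus geometry: depth `≥ R` forces sup-distance `> R` to every other block and to every winding
  image); a row TAIL `Σ_{Far X′ Y′} ‖C′ X′ Y′‖ ≤ T` (`≤ m₁(C′)/R` from a first moment).  Then `near_apply_of_blk_ne` (a cross-block entry of
  `C′`), **`near_apply_of_blk_eq`** (minus the WINDING sum `Σ_{Y″ ≠ Y′, πY″ = πY′} C′ X′ Y″`), **`norm_near_le`** (`≤ T`),
  **`sum_norm_near_row_le`** (`≤ 2T`), and with antisymmetric `C, C′` (fermionic covariances) `norm_near_swap`, **`sum_norm_near_col_le`** (`≤ 2T`);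
* (§4, the Gram data of the three pieces, is the companion file `…TwoVolumeBlockDefectGram`.)

With these two files, every covariance-side hypothesis of `sum_norm_kernel_twoVolumeDefect_le` is discharged from: the block structure, (P), the torus
geometry (G1)/(G2), the decay of `C′` (tail / first moment, sup, row sums) and charged Gram forms of `C′`, `C`; what remains model-side is the
one-volume kernel data of the coarse action (profiles, first moments, smallness) and the read-out.  Sorry-free; no definition.

References: BETA-PRIME-ROADMAP.md (k3c5-p2 g5) §0–§2; VL-E3F-ROADMAP.md §3 (P1)–(P5); BGM 2006 §2 (2.13)–(2.14), (2.80); Salmhofer 1999 (2.102)–(2.106).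
-/

noncomputable section

namespace Summit.HubbardSuperconductivity.HubbardSuperconductivity.Theorems.TwoVolumeDefect

set_option linter.dupNamespace false -- summit = problem name (single-conjunct summit), D-0017

open Finset Literature.MathematicalPhysics.QuantumLattice
open scoped InnerProductSpace

universe u

variable {𝕜 : Type*} [RCLike 𝕜] {Γ ι : Type*} {Γ' : Type u} (e : Γ' ≃ ι × Γ)

/-! ## §1 The decomposition `C′ = C^cop + D_near + D_far` -/

/-- **`C^cop + D_near + D_far = C′`.** [folklore] -/
theorem copies_add_near_add_far (C' Ccop Dn Df : Matrix Γ' Γ' 𝕜) (Zs : Set Γ') [DecidablePred (· ∈ Zs)]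
    (hDf : ∀ X' Y', Df X' Y' = if X' ∈ Zs ∧ Y' ∈ Zs then C' X' Y' - Ccop X' Y' else 0)
    (hDn : ∀ X' Y', Dn X' Y' = if X' ∈ Zs ∧ Y' ∈ Zs then 0 else C' X' Y' - Ccop X' Y') :
    Ccop + Dn + Df = C' := by
  ext X' Y'
  rw [Matrix.add_apply, Matrix.add_apply, hDf, hDn]
  split_ifs <;> abel

/-- `D_far` is supported on `Zs × Zs`. [folklore] -/
theorem far_apply_of_not (C' Ccop Df : Matrix Γ' Γ' 𝕜) (Zs : Set Γ') [DecidablePred (· ∈ Zs)]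
    (hDf : ∀ X' Y', Df X' Y' = if X' ∈ Zs ∧ Y' ∈ Zs then C' X' Y' - Ccop X' Y' else 0) {X' Y' : Γ'}
    (h : ¬ (X' ∈ Zs ∧ Y' ∈ Zs)) : Df X' Y' = 0 := by
  rw [hDf, if_neg h]

/-- `D_near` vanishes on `Zs × Zs`. [folklore] -/
theorem near_apply_of_mem (C' Ccop Dn : Matrix Γ' Γ' 𝕜) (Zs : Set Γ') [DecidablePred (· ∈ Zs)]
    (hDn : ∀ X' Y', Dn X' Y' = if X' ∈ Zs ∧ Y' ∈ Zs then 0 else C' X' Y' - Ccop X' Y') {X' Y' : Γ'}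
    (hX : X' ∈ Zs) (hY : Y' ∈ Zs) : Dn X' Y' = 0 := by
  rw [hDn, if_pos ⟨hX, hY⟩]

/-! ## §2 Sizes of the far defect -/

/-- Entries of the copies covariance are entries of `C` or zero. [folklore] -/
theorem norm_copies_le (C : Matrix Γ Γ 𝕜) (Ccop : Matrix Γ' Γ' 𝕜) [DecidableEq ι]
    (hCcop : ∀ X' Y', Ccop X' Y' = if (e X').1 = (e Y').1 then C (e X').2 (e Y').2 else 0) {s : ℝ} (hs0 : 0 ≤ s)
    (hs : ∀ X Y, ‖C X Y‖ ≤ s) (X' Y' : Γ') : ‖Ccop X' Y'‖ ≤ s := by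
  rw [hCcop]
  split_ifs
  · exact hs _ _
  · rwa [norm_zero]

/-- **Far entries**: `‖D_far X′ Y′‖ ≤ s′ + s`. [folklore] -/
theorem norm_far_le (C : Matrix Γ Γ 𝕜) (C' Ccop Df : Matrix Γ' Γ' 𝕜) [DecidableEq ι] (Zs : Set Γ') [DecidablePred (· ∈ Zs)]
    (hCcop : ∀ X' Y', Ccop X' Y' = if (e X').1 = (e Y').1 then C (e X').2 (e Y').2 else 0)
    (hDf : ∀ X' Y', Df X' Y' = if X' ∈ Zs ∧ Y' ∈ Zs then C' X' Y' - Ccop X' Y' else 0)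
    {s' s : ℝ} (hs'0 : 0 ≤ s') (hs0 : 0 ≤ s) (hs' : ∀ X' Y', ‖C' X' Y'‖ ≤ s') (hs : ∀ X Y, ‖C X Y‖ ≤ s) (X' Y' : Γ') :
    ‖Df X' Y'‖ ≤ s' + s := by
  rw [hDf]
  split_ifs
  · exact (norm_sub_le _ _).trans (add_le_add (hs' _ _) (norm_copies_le e C Ccop hCcop hs0 hs X' Y'))
  · rw [norm_zero]; positivity

/-- **A row of the copies covariance is a row of `C`.** [folklore] -/
theorem sum_norm_copies_row [Fintype Γ] [Fintype Γ'] [Fintype ι] [DecidableEq ι] (C : Matrix Γ Γ 𝕜) (Ccop : Matrix Γ' Γ' 𝕜)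
    (hCcop : ∀ X' Y', Ccop X' Y' = if (e X').1 = (e Y').1 then C (e X').2 (e Y').2 else 0) (X' : Γ') :
    ∑ Y', ‖Ccop X' Y'‖ = ∑ Y, ‖C (e X').2 Y‖ := by
  have h : ∀ Y', ‖Ccop X' Y'‖ = (fun p : ι × Γ => if (e X').1 = p.1 then ‖C (e X').2 p.2‖ else 0) (e Y') := by
    intro Y'
    simp only [hCcop]
    split_ifs <;> simp
  simp_rw [h]
  rw [e.sum_comp (fun p : ι × Γ => if (e X').1 = p.1 then ‖C (e X').2 p.2‖ else 0), Fintype.sum_prod_type]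
  simp

/-- **A column of the copies covariance is a column of `C`.** [folklore] -/
theorem sum_norm_copies_col [Fintype Γ] [Fintype Γ'] [Fintype ι] [DecidableEq ι] (C : Matrix Γ Γ 𝕜) (Ccop : Matrix Γ' Γ' 𝕜)
    (hCcop : ∀ X' Y', Ccop X' Y' = if (e X').1 = (e Y').1 then C (e X').2 (e Y').2 else 0) (Y' : Γ') :
    ∑ X', ‖Ccop X' Y'‖ = ∑ X, ‖C X (e Y').2‖ := by
  have h : ∀ X', ‖Ccop X' Y'‖ = (fun p : ι × Γ => if p.1 = (e Y').1 then ‖C p.2 (e Y').2‖ else 0) (e X') := by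
    intro X'
    simp only [hCcop]
    split_ifs <;> simp
  simp_rw [h]
  rw [e.sum_comp (fun p : ι × Γ => if p.1 = (e Y').1 then ‖C p.2 (e Y').2‖ else 0), Fintype.sum_prod_type]
  simp

/-- Pointwise: `‖D_far X′ Y′‖ ≤ ‖C′ X′ Y′‖ + ‖C^cop X′ Y′‖`. [folklore] -/
theorem norm_far_le_add (C' Ccop Df : Matrix Γ' Γ' 𝕜) (Zs : Set Γ') [DecidablePred (· ∈ Zs)]
    (hDf : ∀ X' Y', Df X' Y' = if X' ∈ Zs ∧ Y' ∈ Zs then C' X' Y' - Ccop X' Y' else 0) (X' Y' : Γ') :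
    ‖Df X' Y'‖ ≤ ‖C' X' Y'‖ + ‖Ccop X' Y'‖ := by
  rw [hDf]
  split_ifs
  · exact norm_sub_le _ _
  · rw [norm_zero]; positivity

/-- **Far rows**: `Σ_{Y′} ‖D_far X′ Y′‖ ≤ α′ + α`. [folklore] -/
theorem sum_norm_far_row_le [Fintype Γ] [Fintype Γ'] [Fintype ι] [DecidableEq ι] (C : Matrix Γ Γ 𝕜) (C' Ccop Df : Matrix Γ' Γ' 𝕜)
    (Zs : Set Γ') [DecidablePred (· ∈ Zs)]
    (hCcop : ∀ X' Y', Ccop X' Y' = if (e X').1 = (e Y').1 then C (e X').2 (e Y').2 else 0)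
    (hDf : ∀ X' Y', Df X' Y' = if X' ∈ Zs ∧ Y' ∈ Zs then C' X' Y' - Ccop X' Y' else 0)
    {α' α : ℝ} (hrow' : ∀ X', ∑ Y', ‖C' X' Y'‖ ≤ α') (hrow : ∀ X, ∑ Y, ‖C X Y‖ ≤ α) (X' : Γ') :
    ∑ Y', ‖Df X' Y'‖ ≤ α' + α := by
  calc ∑ Y', ‖Df X' Y'‖ ≤ ∑ Y', (‖C' X' Y'‖ + ‖Ccop X' Y'‖) := sum_le_sum fun Y' _ => norm_far_le_add C' Ccop Df Zs hDf X' Y'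
    _ = ∑ Y', ‖C' X' Y'‖ + ∑ Y, ‖C (e X').2 Y‖ := by rw [sum_add_distrib, sum_norm_copies_row e C Ccop hCcop]
    _ ≤ α' + α := add_le_add (hrow' X') (hrow _)

/-- **Far columns**: `Σ_{X′} ‖D_far X′ Y′‖ ≤ α′ + α`. [folklore] -/
theorem sum_norm_far_col_le [Fintype Γ] [Fintype Γ'] [Fintype ι] [DecidableEq ι] (C : Matrix Γ Γ 𝕜) (C' Ccop Df : Matrix Γ' Γ' 𝕜)
    (Zs : Set Γ') [DecidablePred (· ∈ Zs)]
    (hCcop : ∀ X' Y', Ccop X' Y' = if (e X').1 = (e Y').1 then C (e X').2 (e Y').2 else 0)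
    (hDf : ∀ X' Y', Df X' Y' = if X' ∈ Zs ∧ Y' ∈ Zs then C' X' Y' - Ccop X' Y' else 0)
    {α' α : ℝ} (hcol' : ∀ Y', ∑ X', ‖C' X' Y'‖ ≤ α') (hcol : ∀ Y, ∑ X, ‖C X Y‖ ≤ α) (Y' : Γ') :
    ∑ X', ‖Df X' Y'‖ ≤ α' + α := by
  calc ∑ X', ‖Df X' Y'‖ ≤ ∑ X', (‖C' X' Y'‖ + ‖Ccop X' Y'‖) := sum_le_sum fun X' _ => norm_far_le_add C' Ccop Df Zs hDf X' Y'
    _ = ∑ X', ‖C' X' Y'‖ + ∑ X, ‖C X (e Y').2‖ := by rw [sum_add_distrib, sum_norm_copies_col e C Ccop hCcop]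
    _ ≤ α' + α := add_le_add (hcol' Y') (hcol _)

/-! ## §3 Sizes of the near defect: periodisation + torus geometry + decay tail -/

/-- **A near entry across blocks is an entry of `C′`.** [folklore] -/
theorem near_apply_of_blk_ne [DecidableEq ι] (C : Matrix Γ Γ 𝕜) (C' Ccop Dn : Matrix Γ' Γ' 𝕜) (Zs : Set Γ') [DecidablePred (· ∈ Zs)]
    (hCcop : ∀ X' Y', Ccop X' Y' = if (e X').1 = (e Y').1 then C (e X').2 (e Y').2 else 0)
    (hDn : ∀ X' Y', Dn X' Y' = if X' ∈ Zs ∧ Y' ∈ Zs then 0 else C' X' Y' - Ccop X' Y') {X' Y' : Γ'}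
    (hne : (e X').1 ≠ (e Y').1) (hnz : ¬ (X' ∈ Zs ∧ Y' ∈ Zs)) : Dn X' Y' = C' X' Y' := by
  rw [hDn, if_neg hnz, hCcop, if_neg hne, sub_zero]

/-- **A near entry inside a block is minus the WINDING SUM** `Σ_{Y″ ≠ Y′, π Y″ = π Y′} C′ X′ Y″` — by the periodisation identity (P)
`Σ_{π Y″ = π Y′} C′ X′ Y″ = C (π X′) (π Y′)`. [folklore] -/
theorem near_apply_of_blk_eq [Fintype Γ'] [DecidableEq Γ'] [DecidableEq Γ] [DecidableEq ι] (C : Matrix Γ Γ 𝕜)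
    (C' Ccop Dn : Matrix Γ' Γ' 𝕜) (Zs : Set Γ') [DecidablePred (· ∈ Zs)]
    (hCcop : ∀ X' Y', Ccop X' Y' = if (e X').1 = (e Y').1 then C (e X').2 (e Y').2 else 0)
    (hDn : ∀ X' Y', Dn X' Y' = if X' ∈ Zs ∧ Y' ∈ Zs then 0 else C' X' Y' - Ccop X' Y')
    (hP : ∀ (X' : Γ') (Y : Γ), ∑ Y'' ∈ univ.filter (fun Y'' : Γ' => (e Y'').2 = Y), C' X' Y'' = C (e X').2 Y)
    {X' Y' : Γ'} (heq : (e X').1 = (e Y').1) (hnz : ¬ (X' ∈ Zs ∧ Y' ∈ Zs)) :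
    Dn X' Y' = -∑ Y'' ∈ (univ.filter (fun Y'' : Γ' => (e Y'').2 = (e Y').2)).erase Y', C' X' Y'' := by
  rw [hDn, if_neg hnz, hCcop, if_pos heq, ← hP X' (e Y').2,
    ← Finset.add_sum_erase _ _ (show Y' ∈ univ.filter (fun Y'' : Γ' => (e Y'').2 = (e Y').2) by simp)]
  abel

/-- **Near entries are tail-small**: `‖D_near X′ Y′‖ ≤ T`, `T` a bound on the far row tails `Σ_{Far X′ Y′} ‖C′ X′ Y′‖`, given the
geometry (G1) (across blocks, not both in the zone ⇒ far) and (G2) (inside a block, not both in the zone ⇒ the other points of the fibre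
are far). [folklore] -/
theorem norm_near_le [Fintype Γ'] [DecidableEq Γ'] [DecidableEq Γ] [DecidableEq ι] (C : Matrix Γ Γ 𝕜)
    (C' Ccop Dn : Matrix Γ' Γ' 𝕜) (Zs : Set Γ') [DecidablePred (· ∈ Zs)]
    (hCcop : ∀ X' Y', Ccop X' Y' = if (e X').1 = (e Y').1 then C (e X').2 (e Y').2 else 0)
    (hDn : ∀ X' Y', Dn X' Y' = if X' ∈ Zs ∧ Y' ∈ Zs then 0 else C' X' Y' - Ccop X' Y')
    (hP : ∀ (X' : Γ') (Y : Γ), ∑ Y'' ∈ univ.filter (fun Y'' : Γ' => (e Y'').2 = Y), C' X' Y'' = C (e X').2 Y)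
    (Far : Γ' → Γ' → Prop) [∀ X' Y', Decidable (Far X' Y')]
    (hG1 : ∀ X' Y', (e X').1 ≠ (e Y').1 → ¬ (X' ∈ Zs ∧ Y' ∈ Zs) → Far X' Y')
    (hG2 : ∀ X' Y' Y'', (e X').1 = (e Y').1 → (e Y'').2 = (e Y').2 → Y'' ≠ Y' → ¬ (X' ∈ Zs ∧ Y' ∈ Zs) → Far X' Y'')
    {T : ℝ} (hT : ∀ X', ∑ Y' ∈ univ.filter (fun Y' : Γ' => Far X' Y'), ‖C' X' Y'‖ ≤ T) (X' Y' : Γ') :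
    ‖Dn X' Y'‖ ≤ T := by
  have hT0 : 0 ≤ T := (sum_nonneg fun Y' _ => norm_nonneg (C' X' Y')).trans (hT X')
  by_cases hnz : X' ∈ Zs ∧ Y' ∈ Zs
  · rw [hDn, if_pos hnz, norm_zero]; exact hT0
  by_cases heq : (e X').1 = (e Y').1
  · rw [near_apply_of_blk_eq e C C' Ccop Dn Zs hCcop hDn hP heq hnz, norm_neg]
    refine (norm_sum_le _ _).trans ((Finset.sum_le_sum_of_subset_of_nonneg ?_ fun _ _ _ => norm_nonneg _).trans (hT X'))
    intro Y'' hY''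
    simp only [mem_erase, mem_filter, mem_univ, true_and] at hY'' ⊢
    exact hG2 X' Y' Y'' heq hY''.2 hY''.1 hnz
  · rw [near_apply_of_blk_ne e C C' Ccop Dn Zs hCcop hDn heq hnz]
    exact (Finset.single_le_sum (f := fun Y' => ‖C' X' Y'‖) (fun _ _ => norm_nonneg _)
      (by simp only [mem_filter, mem_univ, true_and]; exact hG1 X' Y' heq hnz)).trans (hT X')

/-- **Near rows are tail-small**: `Σ_{Y′} ‖D_near X′ Y′‖ ≤ 2T` (cross-block entries are far entries of `C′`; the winding sums over the fibres of
the block are disjoint families of far entries). [folklore] -/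
theorem sum_norm_near_row_le [Fintype Γ'] [DecidableEq Γ'] [DecidableEq Γ] [DecidableEq ι] (C : Matrix Γ Γ 𝕜)
    (C' Ccop Dn : Matrix Γ' Γ' 𝕜) (Zs : Set Γ') [DecidablePred (· ∈ Zs)]
    (hCcop : ∀ X' Y', Ccop X' Y' = if (e X').1 = (e Y').1 then C (e X').2 (e Y').2 else 0)
    (hDn : ∀ X' Y', Dn X' Y' = if X' ∈ Zs ∧ Y' ∈ Zs then 0 else C' X' Y' - Ccop X' Y')
    (hP : ∀ (X' : Γ') (Y : Γ), ∑ Y'' ∈ univ.filter (fun Y'' : Γ' => (e Y'').2 = Y), C' X' Y'' = C (e X').2 Y)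
    (Far : Γ' → Γ' → Prop) [∀ X' Y', Decidable (Far X' Y')]
    (hG1 : ∀ X' Y', (e X').1 ≠ (e Y').1 → ¬ (X' ∈ Zs ∧ Y' ∈ Zs) → Far X' Y')
    (hG2 : ∀ X' Y' Y'', (e X').1 = (e Y').1 → (e Y'').2 = (e Y').2 → Y'' ≠ Y' → ¬ (X' ∈ Zs ∧ Y' ∈ Zs) → Far X' Y'')
    {T : ℝ} (hT : ∀ X', ∑ Y' ∈ univ.filter (fun Y' : Γ' => Far X' Y'), ‖C' X' Y'‖ ≤ T) (X' : Γ') :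
    ∑ Y', ‖Dn X' Y'‖ ≤ 2 * T := by
  -- the far profile of the row `X'`
  set φ : Γ' → ℝ := fun Y'' => if Far X' Y'' then ‖C' X' Y''‖ else 0 with hφ
  have hφ0 : ∀ Y'', 0 ≤ φ Y'' := fun Y'' => by simp only [hφ]; split_ifs <;> simp
  have hφT : ∑ Y'', φ Y'' ≤ T := by rw [hφ, ← Finset.sum_filter]; exact hT X'
  rw [← Finset.sum_filter_add_sum_filter_not univ (fun Y' : Γ' => (e X').1 = (e Y').1), two_mul]
  refine add_le_add ?_ ?_
  · -- same block: winding sums over disjoint fibres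
    have hpt : ∀ Y' ∈ univ.filter (fun Y' : Γ' => (e X').1 = (e Y').1),
        ‖Dn X' Y'‖ ≤ ∑ Y'' ∈ (univ.filter (fun Y'' : Γ' => (e Y'').2 = (e Y').2)).erase Y', φ Y'' := by
      intro Y' hY'
      simp only [mem_filter, mem_univ, true_and] at hY'
      by_cases hnz : X' ∈ Zs ∧ Y' ∈ Zs
      · rw [hDn, if_pos hnz, norm_zero]; exact sum_nonneg fun Y'' _ => hφ0 Y''
      · rw [near_apply_of_blk_eq e C C' Ccop Dn Zs hCcop hDn hP hY' hnz, norm_neg]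
        refine (norm_sum_le _ _).trans (sum_le_sum fun Y'' hY'' => ?_)
        simp only [mem_erase, mem_filter, mem_univ, true_and] at hY''
        rw [hφ]; dsimp only
        rw [if_pos (hG2 X' Y' Y'' hY' hY''.2 hY''.1 hnz)]
    refine (sum_le_sum hpt).trans ?_
    rw [← Finset.sum_biUnion]
    · exact (Finset.sum_le_sum_of_subset_of_nonneg (subset_univ _) fun Y'' _ _ => hφ0 Y'').trans hφT
    · intro Y₁ hY₁ Y₂ hY₂ hne
      simp only [coe_filter, mem_univ, true_and, Set.mem_setOf_eq] at hY₁ hY₂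
      rw [Function.onFun, Finset.disjoint_left]
      intro Y'' h₁ h₂
      simp only [mem_erase, mem_filter, mem_univ, true_and] at h₁ h₂
      apply hne
      apply e.injective
      exact Prod.ext (hY₁.symm.trans hY₂) (h₁.2.symm.trans h₂.2)
  · -- other blocks: far entries of `C′`
    have hpt : ∀ Y' ∈ univ.filter (fun Y' : Γ' => ¬ (e X').1 = (e Y').1), ‖Dn X' Y'‖ ≤ φ Y' := by
      intro Y' hY'
      simp only [mem_filter, mem_univ, true_and] at hY'
      by_cases hnz : X' ∈ Zs ∧ Y' ∈ Zs
      · rw [hDn, if_pos hnz, norm_zero]; exact hφ0 Y'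
      · rw [near_apply_of_blk_ne e C C' Ccop Dn Zs hCcop hDn hY' hnz, hφ]
        dsimp only
        rw [if_pos (hG1 X' Y' hY' hnz)]
    exact (sum_le_sum hpt).trans ((Finset.sum_le_sum_of_subset_of_nonneg (subset_univ _) fun Y'' _ _ => hφ0 Y'').trans hφT)

/-- For antisymmetric `C`, `C′` (fermionic covariances) the near defect is antisymmetric in norm. [folklore] -/
theorem norm_near_swap [DecidableEq ι] (C : Matrix Γ Γ 𝕜) (C' Ccop Dn : Matrix Γ' Γ' 𝕜) (Zs : Set Γ') [DecidablePred (· ∈ Zs)]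
    (hCcop : ∀ X' Y', Ccop X' Y' = if (e X').1 = (e Y').1 then C (e X').2 (e Y').2 else 0)
    (hDn : ∀ X' Y', Dn X' Y' = if X' ∈ Zs ∧ Y' ∈ Zs then 0 else C' X' Y' - Ccop X' Y')
    (hC't : ∀ X' Y', C' Y' X' = -C' X' Y') (hCt : ∀ X Y, C Y X = -C X Y) (X' Y' : Γ') :
    ‖Dn Y' X'‖ = ‖Dn X' Y'‖ := by
  have h : Dn Y' X' = -Dn X' Y' := by
    by_cases hz : X' ∈ Zs ∧ Y' ∈ Zs
    · rw [hDn, if_pos hz.symm, hDn, if_pos hz, neg_zero]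
    · rw [hDn, if_neg (fun h => hz h.symm), hDn, if_neg hz, hCcop, hCcop, hC't X' Y']
      by_cases hb : (e X').1 = (e Y').1
      · rw [if_pos hb.symm, if_pos hb, hCt (e X').2 (e Y').2]; abel
      · rw [if_neg (fun h => hb h.symm), if_neg hb]; abel
  rw [h, norm_neg]

/-- **Near columns are tail-small**: `Σ_{X′} ‖D_near X′ Y′‖ ≤ 2T` for antisymmetric `C`, `C′`. [folklore] -/
theorem sum_norm_near_col_le [Fintype Γ'] [DecidableEq Γ'] [DecidableEq Γ] [DecidableEq ι] (C : Matrix Γ Γ 𝕜)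
    (C' Ccop Dn : Matrix Γ' Γ' 𝕜) (Zs : Set Γ') [DecidablePred (· ∈ Zs)]
    (hCcop : ∀ X' Y', Ccop X' Y' = if (e X').1 = (e Y').1 then C (e X').2 (e Y').2 else 0)
    (hDn : ∀ X' Y', Dn X' Y' = if X' ∈ Zs ∧ Y' ∈ Zs then 0 else C' X' Y' - Ccop X' Y')
    (hP : ∀ (X' : Γ') (Y : Γ), ∑ Y'' ∈ univ.filter (fun Y'' : Γ' => (e Y'').2 = Y), C' X' Y'' = C (e X').2 Y)
    (hC't : ∀ X' Y', C' Y' X' = -C' X' Y') (hCt : ∀ X Y, C Y X = -C X Y)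
    (Far : Γ' → Γ' → Prop) [∀ X' Y', Decidable (Far X' Y')]
    (hG1 : ∀ X' Y', (e X').1 ≠ (e Y').1 → ¬ (X' ∈ Zs ∧ Y' ∈ Zs) → Far X' Y')
    (hG2 : ∀ X' Y' Y'', (e X').1 = (e Y').1 → (e Y'').2 = (e Y').2 → Y'' ≠ Y' → ¬ (X' ∈ Zs ∧ Y' ∈ Zs) → Far X' Y'')
    {T : ℝ} (hT : ∀ X', ∑ Y' ∈ univ.filter (fun Y' : Γ' => Far X' Y'), ‖C' X' Y'‖ ≤ T) (Y' : Γ') :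
    ∑ X', ‖Dn X' Y'‖ ≤ 2 * T := by
  have h : ∀ X', ‖Dn X' Y'‖ = ‖Dn Y' X'‖ := fun X' => norm_near_swap e C C' Ccop Dn Zs hCcop hDn hC't hCt Y' X'
  simp_rw [h]
  exact sum_norm_near_row_le e C C' Ccop Dn Zs hCcop hDn hP Far hG1 hG2 hT Y'

end Summit.HubbardSuperconductivity.HubbardSuperconductivity.Theorems.TwoVolumeDefect

end
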